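import Summits.Ventures.CertifiedArithmetic.LowPrec.GemmEnvelopeScaled
import Summits.Ventures.CertifiedArithmetic.LowPrec.GemmEnvelopeWitnesses

/-!
# GEMM-level envelopes, part (d): decision-table rows as theorems (pub-lowprec gemm gen 22, LXX-d)

HONEST FRAMING: certified error envelopes and provably optimal rounding/accumulation schemes for
low-precision formats under stated cost models; every table by two implementations; no hardware or
vendor claims.

The comparison of two GEMM datapaths `X, Y` on an input class `C` is ENVELOPE INCLUSION
(THEOREM-SHAPES §4.7), written here unfolded: `X ≼ Y on C` iff every uniform relative bound valid
for `Y` on `C` is valid for `X` on `C`,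
`∀ q, (∀ w ∈ C, e_Y(w) ≤ q · L(w)) → (∀ v ∈ C, e_X(v) ≤ q · L(v))`,
with `e = |Σ q̂a·q̂b − Σ a·b|` at exact accumulation (the accumulation line `γ` of E-DEC shifts both
sides identically, parts a/b) and `L = Σ |aᵢ bᵢ|` (functional F1) or `K · Aa · Ab` (functional F2).
Inputs are blocked, `a b : Fin B → Fin k → ℚ`, with COVERING NUMERATORS `Aa, Ab` (`|a j i| ≤ Aa`)
and numerator-to-element dynamic range `≤ κ` — the class `C(κ)`; the per-vector datapaths take
their scale from the numerator (`Aa / maxRat`, `Aa / 127`), the MX datapaths ignore it.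
Datapaths: MX-E4M3 with the CEIL (`SR.ceilScale`) or the OCP FLOOR (`MXBlock.scaleRat`) block scale,
per-vector E4M3 / E5M2, per-vector symmetric INT8 (Mathlib `round`, ties up).
Rows proved here: P3 (MX-ceil vs INT8: holds iff `κ ≥ 254/17`), P7 (ceil vs floor).
Every witness number is reproduced with 0 diff by both pipelines of `certs/gemm/GEMM-ENVELOPES.json`.
[cite: RouhaniEtAl2023MX, §5.1, §6]; [cite: MicikeviciusEtAl2022, §3]; [cite: Higham2002ASNA, §3.1]
-/

namespace Summit.Ventures.CertifiedArithmetic.LowPrec.GemmEnvelope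

open Finset
open Literature.ComputerArithmetic.FloatingPoint
open Literature.ComputerArithmetic.FloatingPoint.Format
open Literature.ComputerArithmetic.FloatingPoint.MiniFloat
open Literature.ComputerArithmetic.FloatingPoint.MXBlock
open Summit.Ventures.CertifiedArithmetic.LowPrec.SR

/-! ## The envelopes on blocked inputs of class `C(κ)` (exact accumulation) -/

/-- INT8 (per-vector, covering numerator, `N = 127`) on `C(κ)`: `e ≤ (κ/127 + κ²/64516) · L`.
[cite: Higham2002ASNA, §3.1] -/
theorem int8_blocked_le {B k : ℕ} (a b : Fin B → Fin k → ℚ) {Aa Ab κ : ℚ}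
    (ha : ∀ j i, |a j i| ≤ Aa ∧ (a j i = 0 ∨ Aa ≤ κ * |a j i|))
    (hb : ∀ j i, |b j i| ≤ Ab ∧ (b j i = 0 ∨ Ab ≤ κ * |b j i|)) :
    |∑ j, ∑ i, (Aa / 127 * (round (a j i / (Aa / 127)) : ℚ)) *
        (Ab / 127 * (round (b j i / (Ab / 127)) : ℚ)) - ∑ j, ∑ i, a j i * b j i|
      ≤ (κ / 127 + κ ^ 2 / 64516) * ∑ j, ∑ i, |a j i * b j i| := by
  have h := gemm_int8_envelope (ι := Fin B × Fin k) (fun p => a p.1 p.2) (fun p => b p.1 p.2)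
    (fun p => Aa / 127 * (round (a p.1 p.2 / (Aa / 127)) : ℚ))
    (fun p => Ab / 127 * (round (b p.1 p.2 / (Ab / 127)) : ℚ))
    (fun p => (ha p.1 p.2).1) (fun p => (hb p.1 p.2).1) (fun p => (ha p.1 p.2).2)
    (fun p => (hb p.1 p.2).2) (fun _ => rfl) (fun _ => rfl)
  simpa only [Fintype.sum_prod_type] using h

/-- Per-vector E4M3 (covering numerator) on `C(κ)`, `κ ≤ 28672`: `e ≤ 35/289 · L`.
[cite: MicikeviciusEtAl2022, §3] -/
theorem vecE4M3_blocked_le {B k : ℕ} (a b : Fin B → Fin k → ℚ) {Aa Ab κ : ℚ} (hκ : κ ≤ 28672)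
    (ha : ∀ j i, |a j i| ≤ Aa ∧ (a j i = 0 ∨ Aa ≤ κ * |a j i|))
    (hb : ∀ j i, |b j i| ≤ Ab ∧ (b j i = 0 ∨ Ab ≤ κ * |b j i|)) :
    |∑ j, ∑ i, (Aa / E4M3.maxRat * (roundNE E4M3 (a j i / (Aa / E4M3.maxRat))).toRat) *
        (Ab / E4M3.maxRat * (roundNE E4M3 (b j i / (Ab / E4M3.maxRat))).toRat)
        - ∑ j, ∑ i, a j i * b j i| ≤ 35 / 289 * ∑ j, ∑ i, |a j i * b j i| := by
  have h := gemm_vec_envelope_E4M3 (ι := Fin B × Fin k) (fun p => a p.1 p.2) (fun p => b p.1 p.2)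
    (fun p => Aa / E4M3.maxRat * (roundNE E4M3 (a p.1 p.2 / (Aa / E4M3.maxRat))).toRat)
    (fun p => Ab / E4M3.maxRat * (roundNE E4M3 (b p.1 p.2 / (Ab / E4M3.maxRat))).toRat)
    (γ := 0) (δ := 0)
    (acc := ∑ p : Fin B × Fin k, (Aa / E4M3.maxRat * (roundNE E4M3 (a p.1 p.2 / (Aa / E4M3.maxRat))).toRat)
      * (Ab / E4M3.maxRat * (roundNE E4M3 (b p.1 p.2 / (Ab / E4M3.maxRat))).toRat))
    (c := ∑ p : Fin B × Fin k, (Aa / E4M3.maxRat * (roundNE E4M3 (a p.1 p.2 / (Aa / E4M3.maxRat))).toRat)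
      * (Ab / E4M3.maxRat * (roundNE E4M3 (b p.1 p.2 / (Ab / E4M3.maxRat))).toRat))
    le_rfl le_rfl hκ (fun p => (ha p.1 p.2).1) (fun p => (hb p.1 p.2).1) (fun p => (ha p.1 p.2).2)
    (fun p => (hb p.1 p.2).2) (fun _ => rfl) (fun _ => rfl) (by simp) (by simp)
  simp only [Fintype.sum_prod_type, zero_mul, add_zero] at h
  exact h

/-- MX-E4M3 with the CEIL block scale on `C(κ)`, `κ ≤ 14336`: `e ≤ 35/289 · L` (the block range is
at most the numerator range). [cite: RouhaniEtAl2023MX, §6.1] -/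
theorem mxCeil_blocked_le {B k : ℕ} (a b : Fin B → Fin k → ℚ) {Aa Ab κ : ℚ} (hκ : κ ≤ 14336)
    (ha : ∀ j i, |a j i| ≤ Aa ∧ (a j i = 0 ∨ Aa ≤ κ * |a j i|))
    (hb : ∀ j i, |b j i| ≤ Ab ∧ (b j i = 0 ∨ Ab ≤ κ * |b j i|)) :
    |∑ j, ∑ i, (ceilScale E4M3 (a j) * (roundNE E4M3 (a j i / ceilScale E4M3 (a j))).toRat) *
        (ceilScale E4M3 (b j) * (roundNE E4M3 (b j i / ceilScale E4M3 (b j))).toRat)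
        - ∑ j, ∑ i, a j i * b j i| ≤ 35 / 289 * ∑ j, ∑ i, |a j i * b j i| := by
  have hca : ∀ j i, a j i = 0 ∨ blockMax (a j) ≤ κ * |a j i| := fun j i =>
    (ha j i).2.imp_right fun h => le_trans
      (blockMax_le_of_forall_le (le_trans (abs_nonneg _) (ha j i).1) fun i' => (ha j i').1) h
  have hcb : ∀ j i, b j i = 0 ∨ blockMax (b j) ≤ κ * |b j i| := fun j i =>
    (hb j i).2.imp_right fun h => le_trans
      (blockMax_le_of_forall_le (le_trans (abs_nonneg _) (hb j i).1) fun i' => (hb j i').1) h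
  have h := gemm_mxCeil_envelope_E4M3 a b
    (fun j i => ceilScale E4M3 (a j) * (roundNE E4M3 (a j i / ceilScale E4M3 (a j))).toRat)
    (fun j i => ceilScale E4M3 (b j) * (roundNE E4M3 (b j i / ceilScale E4M3 (b j))).toRat)
    (γ := 0) (δ := 0)
    (acc := ∑ j, ∑ i, (ceilScale E4M3 (a j) * (roundNE E4M3 (a j i / ceilScale E4M3 (a j))).toRat) *
        (ceilScale E4M3 (b j) * (roundNE E4M3 (b j i / ceilScale E4M3 (b j))).toRat))
    (c := ∑ j, ∑ i, (ceilScale E4M3 (a j) * (roundNE E4M3 (a j i / ceilScale E4M3 (a j))).toRat) *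
        (ceilScale E4M3 (b j) * (roundNE E4M3 (b j i / ceilScale E4M3 (b j))).toRat))
    le_rfl le_rfl hκ hca hcb (fun _ _ => rfl) (fun _ _ => rfl) (by simp) (by simp)
  simp only [zero_mul, add_zero] at h
  exact h

/-! ## Witness arithmetic -/

/-- A CONSTANT witness turns a uniform bound into a bound on one ratio: products `P`, exact
products `X > 0` (both signs of `P − X`). [folklore] -/
theorem ratio_le_of_const_witness {B k : ℕ} (hB : 0 < B) (hk : 0 < k) {P X q : ℚ} (hX : 0 < X)
    (h : |∑ _j : Fin B, ∑ _i : Fin k, P - ∑ _j : Fin B, ∑ _i : Fin k, X|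
      ≤ q * ∑ _j : Fin B, ∑ _i : Fin k, |X|) : (P - X) / X ≤ q ∧ (X - P) / X ≤ q := by
  simp only [sum_const, card_univ, Fintype.card_fin, nsmul_eq_mul] at h
  rw [abs_of_pos hX] at h
  have hBk : (0 : ℚ) < (B : ℚ) * (k : ℚ) := by positivity
  have e : (B : ℚ) * ((k : ℚ) * P) - (B : ℚ) * ((k : ℚ) * X) = (B : ℚ) * (k : ℚ) * (P - X) := by ring
  rw [e, abs_mul, abs_of_pos hBk] at h
  have h1 := le_abs_self (P - X)
  have h2 := neg_abs_le (P - X)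
  have h3 : (B : ℚ) * (k : ℚ) * |P - X| ≤ (B : ℚ) * (k : ℚ) * (q * X) := by linarith
  have h4 : |P - X| ≤ q * X := le_of_mul_le_mul_left h3 hBk
  rw [div_le_iff₀ hX, div_le_iff₀ hX]
  constructor <;> linarith

/-- The sup `35/289` of the approach family `(288/x)² − 1`, `x ↓ 272`, is forced on every uniform
bound although no member attains it (the W5 mechanism: `272` itself ties to even). [folklore] -/
theorem le_of_forall_approach {q : ℚ}
    (h : ∀ x : ℚ, 272 < x → x < 288 → (288 * 288 - x * x) / (x * x) ≤ q) : 35 / 289 ≤ q := by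
  by_contra hq
  push Not at hq
  have h280 := h 280 (by norm_num) (by norm_num)
  have hq0 : 0 < q := lt_of_lt_of_le (by norm_num) h280
  set D : ℚ := 35 / 289 - q with hD
  have hDpos : 0 < D := by rw [hD]; linarith
  set t : ℚ := min 1 (60 * D) with ht
  have ht0 : 0 < t := by rw [ht]; exact lt_min one_pos (by linarith)
  have ht1 : t ≤ 1 := min_le_left _ _
  have ht60 : t ≤ 60 * D := min_le_right _ _
  have hx := h (272 + t) (by linarith) (by linarith)
  have hxx : (0 : ℚ) < (272 + t) * (272 + t) := by positivity
  rw [div_le_iff₀ hxx] at hx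
  -- `hx : 288² − x² ≤ q·x²`, i.e. `82944 ≤ (1+q)·x²`; but `(1+q)·x² < 82944`:
  have hsq : (272 + t) * (272 + t) ≤ 73984 + 545 * t := by nlinarith
  have hprod : (1 + q) * ((272 + t) * (272 + t)) ≤ (1 + q) * (73984 + 545 * t) :=
    mul_le_mul_of_nonneg_left hsq (by linarith)
  have hqt : q * (545 * t) < (35 / 289) * (545 * t) := by nlinarith
  nlinarith

/-! ## Row P3 — MX-E4M3 (ceil scale) vs per-vector INT8 on `C(κ)` -/

/-- **ROW P3 (holds above the crossover)**: for `254/17 ≤ κ ≤ 14336`, MX-E4M3 with the CEIL block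
scale is envelope-included in per-vector INT8 on `C(κ)`: every uniform relative bound valid for
INT8 on the class is valid for MX.  Witness forcing `q ≥ 35/289` on the INT8 side: all entries
`17/2` with numerator `127` (`8.5 ↦ 9`). [cite: RouhaniEtAl2023MX, §5.1] -/
theorem row_P3_mxCeil_le_int8 {B k : ℕ} (hB : 0 < B) (hk : 0 < k) {κ : ℚ} (hκ1 : 254 / 17 ≤ κ)
    (hκ2 : κ ≤ 14336) (q : ℚ)
    (hY : ∀ (a b : Fin B → Fin k → ℚ) (Aa Ab : ℚ),
      (∀ j i, |a j i| ≤ Aa ∧ (a j i = 0 ∨ Aa ≤ κ * |a j i|)) →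
      (∀ j i, |b j i| ≤ Ab ∧ (b j i = 0 ∨ Ab ≤ κ * |b j i|)) →
      |∑ j, ∑ i, (Aa / 127 * (round (a j i / (Aa / 127)) : ℚ)) *
          (Ab / 127 * (round (b j i / (Ab / 127)) : ℚ)) - ∑ j, ∑ i, a j i * b j i|
        ≤ q * ∑ j, ∑ i, |a j i * b j i|)
    (a b : Fin B → Fin k → ℚ) (Aa Ab : ℚ)
    (ha : ∀ j i, |a j i| ≤ Aa ∧ (a j i = 0 ∨ Aa ≤ κ * |a j i|))
    (hb : ∀ j i, |b j i| ≤ Ab ∧ (b j i = 0 ∨ Ab ≤ κ * |b j i|)) :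
    |∑ j, ∑ i, (ceilScale E4M3 (a j) * (roundNE E4M3 (a j i / ceilScale E4M3 (a j))).toRat) *
        (ceilScale E4M3 (b j) * (roundNE E4M3 (b j i / ceilScale E4M3 (b j))).toRat)
        - ∑ j, ∑ i, a j i * b j i| ≤ q * ∑ j, ∑ i, |a j i * b j i| := by
  have hmem : ∀ (j : Fin B) (i : Fin k), |(fun (_ : Fin B) (_ : Fin k) => (17 : ℚ) / 2) j i| ≤ 127 ∧
      ((fun (_ : Fin B) (_ : Fin k) => (17 : ℚ) / 2) j i = 0 ∨
        127 ≤ κ * |(fun (_ : Fin B) (_ : Fin k) => (17 : ℚ) / 2) j i|) := fun _ _ => by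
    refine ⟨by rw [abs_of_pos (by norm_num)]; norm_num, Or.inr ?_⟩
    rw [abs_of_pos (by norm_num)]; linarith
  have hw := hY _ _ 127 127 hmem hmem
  have h9 : (round ((17 : ℚ) / 2 / (127 / 127)) : ℚ) = 9 := by
    rw [show (17 : ℚ) / 2 / (127 / 127) = 17 / 2 by norm_num, witness_values.2.2.2.2.2.1]; norm_num
  simp only [h9] at hw
  have hq := (ratio_le_of_const_witness hB hk (by norm_num) hw).1
  norm_num at hq
  have hL : 0 ≤ ∑ j, ∑ i, |a j i * b j i| :=
    Finset.sum_nonneg fun j _ => Finset.sum_nonneg fun i _ => abs_nonneg _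
  exact le_trans (mxCeil_blocked_le a b hκ2 ha hb) (mul_le_mul_of_nonneg_right hq hL)

/-- **ROW P3 (fails below the crossover)**: for `1 ≤ κ < 254/17` the inclusion FAILS: INT8 satisfies
the uniform bound `q₀ = κ/127 + κ²/64516 < 35/289` on `C(κ)`, while the MX input with all entries
`x = (272 + 288·254/(254+κ))/2 ∈ (272, 288)` (numerators `x`, range `1`) has relative error
`(288/x)² − 1 > q₀`. [cite: RouhaniEtAl2023MX, §5.1] -/
theorem row_P3_fails_below {B k : ℕ} (hB : 0 < B) (hk : 0 < k) {κ : ℚ} (hκ1 : 1 ≤ κ)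
    (hκ2 : κ < 254 / 17) :
    ∃ q : ℚ, (∀ (a b : Fin B → Fin k → ℚ) (Aa Ab : ℚ),
      (∀ j i, |a j i| ≤ Aa ∧ (a j i = 0 ∨ Aa ≤ κ * |a j i|)) →
      (∀ j i, |b j i| ≤ Ab ∧ (b j i = 0 ∨ Ab ≤ κ * |b j i|)) →
      |∑ j, ∑ i, (Aa / 127 * (round (a j i / (Aa / 127)) : ℚ)) *
          (Ab / 127 * (round (b j i / (Ab / 127)) : ℚ)) - ∑ j, ∑ i, a j i * b j i|
        ≤ q * ∑ j, ∑ i, |a j i * b j i|) ∧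
    ∃ (a b : Fin B → Fin k → ℚ) (Aa Ab : ℚ),
      (∀ j i, |a j i| ≤ Aa ∧ (a j i = 0 ∨ Aa ≤ κ * |a j i|)) ∧
      (∀ j i, |b j i| ≤ Ab ∧ (b j i = 0 ∨ Ab ≤ κ * |b j i|)) ∧
      q * ∑ j, ∑ i, |a j i * b j i| <
      |∑ j, ∑ i, (ceilScale E4M3 (a j) * (roundNE E4M3 (a j i / ceilScale E4M3 (a j))).toRat) *
          (ceilScale E4M3 (b j) * (roundNE E4M3 (b j i / ceilScale E4M3 (b j))).toRat)
          - ∑ j, ∑ i, a j i * b j i| := by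
  obtain ⟨n, rfl⟩ : ∃ n, k = n + 1 := ⟨k - 1, by omega⟩
  refine ⟨κ / 127 + κ ^ 2 / 64516, fun a b Aa Ab ha hb => int8_blocked_le a b ha hb, ?_⟩
  -- the witness
  set y : ℚ := 288 * 254 / (254 + κ) with hy
  have hκp : 0 < 254 + κ := by linarith
  have hy1 : 272 < y := by rw [hy, lt_div_iff₀ hκp]; linarith
  have hy2 : y ≤ 288 := by rw [hy, div_le_iff₀ hκp]; nlinarith
  have hyk : (254 + κ) * y = 288 * 254 := by rw [hy]; field_simp
  set x : ℚ := (272 + y) / 2 with hx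
  have hx1 : 272 < x := by rw [hx]; linarith
  have hx2 : x < y := by rw [hx]; linarith
  have hx0 : 0 < x := by linarith
  have hmem : ∀ (j : Fin B) (i : Fin (n + 1)), |(fun (_ : Fin B) (_ : Fin (n + 1)) => x) j i| ≤ x ∧
      ((fun (_ : Fin B) (_ : Fin (n + 1)) => x) j i = 0 ∨
        x ≤ κ * |(fun (_ : Fin B) (_ : Fin (n + 1)) => x) j i|) := fun _ _ => by
    refine ⟨by rw [abs_of_pos hx0], Or.inr ?_⟩
    rw [abs_of_pos hx0]; nlinarith
  refine ⟨fun _ _ => x, fun _ _ => x, x, x, hmem, hmem, ?_⟩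
  have h288 : ceilScale E4M3 (fun _ : Fin (n + 1) => x) *
      (roundNE E4M3 (x / ceilScale E4M3 (fun _ : Fin (n + 1) => x))).toRat = 288 := by
    have h := mxCeil_const_eq_288 n hx1 (by linarith) (0 : Fin (n + 1)); beta_reduce at h; exact h
  simp only [h288, sum_const, card_univ, Fintype.card_fin, nsmul_eq_mul]
  rw [abs_of_pos (mul_pos hx0 hx0)]
  have hBk : (0 : ℚ) < (B : ℚ) * ((n + 1 : ℕ) : ℚ) := by positivity
  -- key: (1 + q₀)·x² = ((254+κ)·x/254)² < ((254+κ)·y/254)² = 288²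
  have hlt : (254 + κ) * x < 288 * 254 := by nlinarith
  have hpos : 0 < (254 + κ) * x := by positivity
  have key : (κ / 127 + κ ^ 2 / 64516) * (x * x) < 288 * 288 - x * x := by nlinarith
  have hdiff : 0 < (B : ℚ) * (((n + 1 : ℕ) : ℚ) * (288 * 288)) - (B : ℚ) * (((n + 1 : ℕ) : ℚ) * (x * x)) := by
    nlinarith
  rw [abs_of_pos hdiff]
  nlinarith

/-! ## Row P7 — CEIL vs FLOOR block scale (MX-E4M3) on `C(κ)` -/

/-- **ROW P7**: for `1 ≤ κ ≤ 14336` the CEIL scale is envelope-included in the OCP FLOOR scale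
(witness forcing `q ≥ 3081/15625 > 35/289` on the floor side: all entries `500`, clipped to `448`),
and the converse inclusion FAILS (`q = 35/289` bounds ceil, the same witness violates it for floor).
[cite: RouhaniEtAl2023MX, §6.3] -/
theorem row_P7_ceil_vs_floor {B k : ℕ} (hB : 0 < B) (hk : 0 < k) {κ : ℚ} (hκ1 : 1 ≤ κ)
    (hκ2 : κ ≤ 14336) :
    (∀ q : ℚ, (∀ (a b : Fin B → Fin k → ℚ) (Aa Ab : ℚ),
        (∀ j i, |a j i| ≤ Aa ∧ (a j i = 0 ∨ Aa ≤ κ * |a j i|)) →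
        (∀ j i, |b j i| ≤ Ab ∧ (b j i = 0 ∨ Ab ≤ κ * |b j i|)) →
        |∑ j, ∑ i, (scaleRat E4M3 (a j) * (roundNE E4M3 (a j i / scaleRat E4M3 (a j))).toRat) *
            (scaleRat E4M3 (b j) * (roundNE E4M3 (b j i / scaleRat E4M3 (b j))).toRat)
            - ∑ j, ∑ i, a j i * b j i| ≤ q * ∑ j, ∑ i, |a j i * b j i|) →
      ∀ (a b : Fin B → Fin k → ℚ) (Aa Ab : ℚ),
        (∀ j i, |a j i| ≤ Aa ∧ (a j i = 0 ∨ Aa ≤ κ * |a j i|)) →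
        (∀ j i, |b j i| ≤ Ab ∧ (b j i = 0 ∨ Ab ≤ κ * |b j i|)) →
        |∑ j, ∑ i, (ceilScale E4M3 (a j) * (roundNE E4M3 (a j i / ceilScale E4M3 (a j))).toRat) *
            (ceilScale E4M3 (b j) * (roundNE E4M3 (b j i / ceilScale E4M3 (b j))).toRat)
            - ∑ j, ∑ i, a j i * b j i| ≤ q * ∑ j, ∑ i, |a j i * b j i|) ∧
    ∃ q : ℚ, (∀ (a b : Fin B → Fin k → ℚ) (Aa Ab : ℚ),
        (∀ j i, |a j i| ≤ Aa ∧ (a j i = 0 ∨ Aa ≤ κ * |a j i|)) →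
        (∀ j i, |b j i| ≤ Ab ∧ (b j i = 0 ∨ Ab ≤ κ * |b j i|)) →
        |∑ j, ∑ i, (ceilScale E4M3 (a j) * (roundNE E4M3 (a j i / ceilScale E4M3 (a j))).toRat) *
            (ceilScale E4M3 (b j) * (roundNE E4M3 (b j i / ceilScale E4M3 (b j))).toRat)
            - ∑ j, ∑ i, a j i * b j i| ≤ q * ∑ j, ∑ i, |a j i * b j i|) ∧
      ∃ (a b : Fin B → Fin k → ℚ) (Aa Ab : ℚ),
        (∀ j i, |a j i| ≤ Aa ∧ (a j i = 0 ∨ Aa ≤ κ * |a j i|)) ∧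
        (∀ j i, |b j i| ≤ Ab ∧ (b j i = 0 ∨ Ab ≤ κ * |b j i|)) ∧
        q * ∑ j, ∑ i, |a j i * b j i| <
        |∑ j, ∑ i, (scaleRat E4M3 (a j) * (roundNE E4M3 (a j i / scaleRat E4M3 (a j))).toRat) *
            (scaleRat E4M3 (b j) * (roundNE E4M3 (b j i / scaleRat E4M3 (b j))).toRat)
            - ∑ j, ∑ i, a j i * b j i| := by
  obtain ⟨n, rfl⟩ : ∃ n, k = n + 1 := ⟨k - 1, by omega⟩
  have hmem : ∀ (j : Fin B) (i : Fin (n + 1)), |(fun (_ : Fin B) (_ : Fin (n + 1)) => (500 : ℚ)) j i| ≤ 500 ∧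
      ((fun (_ : Fin B) (_ : Fin (n + 1)) => (500 : ℚ)) j i = 0 ∨
        500 ≤ κ * |(fun (_ : Fin B) (_ : Fin (n + 1)) => (500 : ℚ)) j i|) := fun _ _ => by
    refine ⟨by rw [abs_of_pos (by norm_num)], Or.inr ?_⟩
    rw [abs_of_pos (by norm_num)]; linarith
  have h448 : scaleRat E4M3 (fun _ : Fin (n + 1) => (500 : ℚ)) *
      (roundNE E4M3 (500 / scaleRat E4M3 (fun _ : Fin (n + 1) => (500 : ℚ)))).toRat = 448 := by
    have h := (mx_const_500 n (0 : Fin (n + 1))).2; beta_reduce at h; exact h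
  have hL : ∀ (a b : Fin B → Fin (n + 1) → ℚ), 0 ≤ ∑ j, ∑ i, |a j i * b j i| := fun a b =>
    Finset.sum_nonneg fun j _ => Finset.sum_nonneg fun i _ => abs_nonneg _
  refine ⟨fun q hY a b Aa Ab ha hb => ?_, ⟨35 / 289, fun a b Aa Ab ha hb => mxCeil_blocked_le a b hκ2 ha hb, ?_⟩⟩
  · have hw := hY _ _ 500 500 hmem hmem
    simp only [h448] at hw
    have hq := (ratio_le_of_const_witness hB (Nat.succ_pos n) (by norm_num : (0:ℚ) < 500 * 500) hw).2
    norm_num at hq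
    exact le_trans (mxCeil_blocked_le a b hκ2 ha hb)
      (mul_le_mul_of_nonneg_right (by linarith) (hL a b))
  · refine ⟨fun _ _ => 500, fun _ _ => 500, 500, 500, hmem, hmem, ?_⟩
    simp only [h448, sum_const, card_univ, Fintype.card_fin, nsmul_eq_mul]
    have hBk : (0 : ℚ) < (B : ℚ) * ((n + 1 : ℕ) : ℚ) := by positivity
    rw [abs_of_pos (by norm_num : (0 : ℚ) < 500 * 500),
      abs_of_neg (by nlinarith : (B : ℚ) * (((n + 1 : ℕ) : ℚ) * (448 * 448))
        - (B : ℚ) * (((n + 1 : ℕ) : ℚ) * (500 * 500)) < 0)]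
    nlinarith

end Summit.Ventures.CertifiedArithmetic.LowPrec.GemmEnvelope
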